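import Summits.BirchSwinnertonDyer.Rank1Residual.GaloisImage.TameThreeTorsionValuation
import Mathlib.Algebra.Polynomial.Splits
import Mathlib.FieldTheory.IsAlgClosed.Basic
import HarnessLib

/-!
# Valuations of the `3`-torsion abscissae on a Kodaira-`III`-shaped model at `3` — CASE A
# (cell `b2b-bsdres`, team n1011, seat p14 gen 2, OWNERS row T-b9 'tame tower at 3', step S1, sequel)

HONEST FRAMING (cell `b2b-bsdres`, run/shared/lean/b2b/bsd-rank1-residual/, verbatim in every
file): the goal of the cell is to DELETE the COMBINATION-SHAPED residual classes of the
Birch–Swinnerton-Dyer formula for ALL analytic-rank `≤ 1` elliptic curves over `ℚ` — "full BSD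
formula for every rank `≤ 1` curve in class `C`" assembled STRICTLY from published theorems — so
that the rank-`≤ 1` remainder becomes exactly the CONSTRUCTION-SHAPED classes, which are TYPED
(missing-input `Prop`s), NOT attempted. This is not "finishing BSD". Team n1011 (N10 / N11, the
additive block X4 ∧ `p = 3`): research route on the CONSTRUCTION-SHAPED class X4; no claim beyond the
stated classes; nothing is booked. Theorems only (no definition, no named fact).

## What this file proves

Sequel of `GaloisImage/TameThreeTorsionValuation.lean` (CASE B, `9 ∣ b₂`): here **CASE A**,
`3 ∥ b₂` (with `3 ∥ b₄`, `9 ∣ b₆`): every root `ξ ∈ ℚ̄` of `ψ₃ = 3X⁴ + b₂X³ + 3b₄X² + 3b₆X + b₈`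
has `v(ξ) = 1` or `v(ξ)³ = v(3)` — the Newton polygon of `ψ₃` at `3` has the two slopes `0` and
`-1/3` (`valuation_eq_one_or_pow_three_eq_of_isRoot_Ψ₃`), and at least one root is a non-unit,
`v(ξ)³ = v(3)` (`exists_isRoot_Ψ₃_valuation_pow_three_eq`, from `b₈ = 3∏(-ξᵢ)`).  Numerics (research note
`HOME/b2b-bsdres-n1011-p14/e4/TAME-TOWER-NOTE.md`): this is the pattern {0, 1/3} of the 1 951
Kodaira-III cells with `v₃(A₂) = 1` in the X4@3 r0 residue.  Step S1 only; no tower claimed.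

References: Tate 1975 / Silverman *ATAEC* IV.9.4; Silverman *AEC* Ex. 3.7.
-/

noncomputable section

open scoped Classical

open Polynomial WeierstrassCurve

namespace Summit.BirchSwinnertonDyer.Rank1Residual.GaloisImage

open Literature.NumberTheory.EllipticCurves

variable (V : WeierstrassCurve ℤ)

/-- **CASE A (`3 ∥ b₂`): every root of `ψ₃` has `v(ξ) = 1` or `v(ξ)³ = v(3)`** — the Newton polygon
of `ψ₃` has the two slopes `0` (one root) and `-1/3` (three roots): between them `b₂ξ³` dominates,
below them `b₈`. [folklore] -/
theorem valuation_eq_one_or_pow_three_eq_of_isRoot_Ψ₃ (hb2 : (3 : ℤ) ∣ V.b₂)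
    (hb2' : ¬ (9 : ℤ) ∣ V.b₂) (hb4 : (3 : ℤ) ∣ V.b₄) (hb4' : ¬ (9 : ℤ) ∣ V.b₄)
    (hb6 : (9 : ℤ) ∣ V.b₆) {x : AlgebraicClosure ℚ}
    (hx : (V.Ψ₃.map (Int.castRingHom (AlgebraicClosure ℚ))).IsRoot x) :
    (placeOver 3).valuation x = 1 ∨
      (placeOver 3).valuation x ^ 3 = (placeOver 3).valuation (3 : AlgebraicClosure ℚ) := by
  set v := (placeOver 3).valuation with hv
  set t := v (3 : AlgebraicClosure ℚ) with ht
  have ht1 : t < 1 := valuation_three_lt_one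
  have ht0 : t ≠ 0 := valuation_three_ne_zero
  have hb2v : v (V.b₂ : AlgebraicClosure ℚ) = t := valuation_intCast_eq_of_dvd_of_not_dvd hb2 hb2'
  have hb4v : v (V.b₄ : AlgebraicClosure ℚ) = t := valuation_intCast_eq_of_dvd_of_not_dvd hb4 hb4'
  have hb6v : v (V.b₆ : AlgebraicClosure ℚ) ≤ t ^ 2 :=
    valuation_intCast_le_pow_of_dvd (n := V.b₆) (k := 2) (by norm_num; exact hb6)
  have hb8v : v (V.b₈ : AlgebraicClosure ℚ) = t ^ 2 := valuation_b₈_eq_of_shape V hb2 hb4 hb4' hb6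
  have heval := eq_zero_of_isRoot_Ψ₃ V x hx
  set u := v x with hu
  have hule : u ≤ 1 := valuation_le_one_of_isRoot_Ψ₃ V hb2 hb4 hb6 hx
  by_cases hu1 : u = 1
  · exact Or.inl hu1
  right
  have hult : u < 1 := lt_of_le_of_ne hule hu1
  have htt : t ^ 2 < t := by
    calc t ^ 2 = t * t := sq t
      _ < t * 1 := mul_lt_mul_left_of_ne_zero ht0 ht1
      _ = t := mul_one _
  rcases lt_trichotomy (u ^ 3) t with hlt | heq | hgt
  · -- `b₈` dominates
    exfalso
    have h1 : v (3 * x ^ 4) < t ^ 2 := by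
      rw [map_mul, map_pow, sq]
      calc t * u ^ 4 ≤ t * u ^ 3 :=
            mul_le_mul' le_rfl (pow_le_pow_of_le_one' hule (show 3 ≤ 4 by norm_num))
        _ < t * t := mul_lt_mul_left_of_ne_zero ht0 hlt
    have h2 : v ((V.b₂ : AlgebraicClosure ℚ) * x ^ 3) < t ^ 2 := by
      rw [map_mul, map_pow, hb2v, sq]; exact mul_lt_mul_left_of_ne_zero ht0 hlt
    have h3 : v (3 * (V.b₄ : AlgebraicClosure ℚ) * x ^ 2) < t ^ 2 := by
      rw [map_mul, map_mul, map_pow, hb4v, ← sq]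
      calc t ^ 2 * u ^ 2 < t ^ 2 * 1 :=
            mul_lt_mul_left_of_ne_zero (pow_ne_zero 2 ht0) (pow_lt_one₀ zero_le hult (by norm_num))
        _ = t ^ 2 := mul_one _
    have h4 : v (3 * (V.b₆ : AlgebraicClosure ℚ) * x) < t ^ 2 := by
      rw [map_mul, map_mul]
      calc t * v (V.b₆ : AlgebraicClosure ℚ) * u ≤ t * t ^ 2 * 1 := by gcongr
        _ = t ^ 2 * t := by rw [mul_one, mul_comm]
        _ < t ^ 2 * 1 := mul_lt_mul_left_of_ne_zero (pow_ne_zero 2 ht0) ht1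
        _ = t ^ 2 := mul_one _
    have hr : v (3 * x ^ 4 + (V.b₂ : AlgebraicClosure ℚ) * x ^ 3 +
        3 * (V.b₄ : AlgebraicClosure ℚ) * x ^ 2 + 3 * (V.b₆ : AlgebraicClosure ℚ) * x) <
        v (V.b₈ : AlgebraicClosure ℚ) := by
      rw [hb8v]
      exact Valuation.map_add_lt _ (Valuation.map_add_lt _ (Valuation.map_add_lt _ h1 h2) h3) h4
    refine false_of_dominant v ?_ hr
    rw [← heval]; ring
  · exact heq
  · -- `b₂ x³` dominates
    exfalso
    have hu0 : u ≠ 0 := by rintro h0; rw [h0, zero_pow (by norm_num)] at hgt; exact not_lt_zero hgt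
    have htu : t < u := hgt.trans_le (by simpa using pow_le_pow_of_le_one' hule (show 1 ≤ 3 by norm_num))
    have hd : v ((V.b₂ : AlgebraicClosure ℚ) * x ^ 3) = t * u ^ 3 := by rw [map_mul, map_pow, hb2v]
    have h1 : v (3 * x ^ 4) < t * u ^ 3 := by
      rw [map_mul, map_pow]
      have key : u ^ 3 * u < u ^ 3 * 1 := mul_lt_mul_left_of_ne_zero (pow_ne_zero 3 hu0) hult
      calc t * u ^ 4 = t * (u ^ 3 * u) := by rw [← pow_succ]
        _ < t * (u ^ 3 * 1) := mul_lt_mul_left_of_ne_zero ht0 key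
        _ = t * u ^ 3 := by rw [mul_one]
    have h2 : v (3 * (V.b₄ : AlgebraicClosure ℚ) * x ^ 2) < t * u ^ 3 := by
      rw [map_mul, map_mul, map_pow, hb4v]
      have key : t * u ^ 2 < u * u ^ 2 := mul_lt_mul_right_of_ne_zero' (pow_ne_zero 2 hu0) htu
      calc t * t * u ^ 2 = t * (t * u ^ 2) := mul_assoc _ _ _
        _ < t * (u * u ^ 2) := mul_lt_mul_left_of_ne_zero ht0 key
        _ = t * u ^ 3 := by rw [← pow_succ']
    have h3 : v (3 * (V.b₆ : AlgebraicClosure ℚ) * x) < t * u ^ 3 := by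
      rw [map_mul, map_mul]
      have htu2 : t ^ 2 < u ^ 2 := pow_lt_pow_left₀ htu zero_le (by norm_num)
      have key : t ^ 2 * u < u ^ 2 * u := mul_lt_mul_right_of_ne_zero' hu0 htu2
      calc t * v (V.b₆ : AlgebraicClosure ℚ) * u ≤ t * t ^ 2 * u := by gcongr
        _ = t * (t ^ 2 * u) := mul_assoc _ _ _
        _ < t * (u ^ 2 * u) := mul_lt_mul_left_of_ne_zero ht0 key
        _ = t * u ^ 3 := by rw [← pow_succ]
    have h4 : v (V.b₈ : AlgebraicClosure ℚ) < t * u ^ 3 := by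
      rw [hb8v, sq]; exact mul_lt_mul_left_of_ne_zero ht0 hgt
    have hr : v (3 * x ^ 4 + 3 * (V.b₄ : AlgebraicClosure ℚ) * x ^ 2 +
        3 * (V.b₆ : AlgebraicClosure ℚ) * x + (V.b₈ : AlgebraicClosure ℚ)) <
        v ((V.b₂ : AlgebraicClosure ℚ) * x ^ 3) := by
      rw [hd]
      exact Valuation.map_add_lt _ (Valuation.map_add_lt _ (Valuation.map_add_lt _ h1 h2) h3) h4
    refine false_of_dominant v ?_ hr
    rw [← heval]; ring

/-- **CASE A (`3 ∥ b₂`): some root of `ψ₃` has `v(ξ)³ = v(3)`** (in fact three of the four do):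
`ψ₃ = 3 ∏ (X - ξᵢ)` splits in `ℚ̄` and its constant term `b₈ = 3 ∏ (-ξᵢ)` has valuation `v(3)²`, so
not every root is a unit; a non-unit root has `v(ξ)³ = v(3)` by
`valuation_eq_one_or_pow_three_eq_of_isRoot_Ψ₃`.  (This is the root over which the points of order
`9` acquire abscissae of valuation `13/27`, research note §3.) [folklore] -/
theorem exists_isRoot_Ψ₃_valuation_pow_three_eq (hb2 : (3 : ℤ) ∣ V.b₂)
    (hb2' : ¬ (9 : ℤ) ∣ V.b₂) (hb4 : (3 : ℤ) ∣ V.b₄) (hb4' : ¬ (9 : ℤ) ∣ V.b₄)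
    (hb6 : (9 : ℤ) ∣ V.b₆) :
    ∃ x : AlgebraicClosure ℚ, (V.Ψ₃.map (Int.castRingHom (AlgebraicClosure ℚ))).IsRoot x ∧
      (placeOver 3).valuation x ^ 3 = (placeOver 3).valuation (3 : AlgebraicClosure ℚ) := by
  set v := (placeOver 3).valuation with hv
  set t := v (3 : AlgebraicClosure ℚ) with ht
  have ht1 : t < 1 := valuation_three_lt_one
  have ht0 : t ≠ 0 := valuation_three_ne_zero
  set F := V.Ψ₃.map (Int.castRingHom (AlgebraicClosure ℚ)) with hF
  by_contra hcon
  simp only [not_exists, not_and] at hcon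
  -- every root is then a unit
  have hunit : ∀ x, F.IsRoot x → v x = 1 := fun x hx ↦
    (valuation_eq_one_or_pow_three_eq_of_isRoot_Ψ₃ V hb2 hb2' hb4 hb4' hb6 hx).resolve_right (hcon x hx)
  -- `F = 3 ∏ (X - ξ)` over its roots
  have hsplit : F = C F.leadingCoeff * (F.roots.map (X - C ·)).prod :=
    (IsAlgClosed.splits F).eq_prod_roots
  have h3 : (3 : ℤ) ≠ 0 := by norm_num
  have hdegF : F.natDegree = 4 := by
    rw [hF, natDegree_map_eq_of_injective (Int.castRingHom (AlgebraicClosure ℚ)).injective_int]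
    exact V.natDegree_Ψ₃ h3
  have hlc : F.leadingCoeff = 3 := by
    rw [leadingCoeff, hdegF, hF, coeff_map, coeff_Ψ₃]; simp
  have hF0 : F ≠ 0 := by
    intro h0; rw [h0, natDegree_zero] at hdegF; exact absurd hdegF (by norm_num)
  -- evaluate at `0`: `b₈ = 3 ∏ (-ξ)`
  have hev0 : F.eval 0 = (V.b₈ : AlgebraicClosure ℚ) := by
    rw [hF, eval_map_Ψ₃]; ring
  have hev0' : F.eval 0 = 3 * (F.roots.map (fun a ↦ (0 : AlgebraicClosure ℚ) - a)).prod := by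
    have := congrArg (eval (0 : AlgebraicClosure ℚ)) hsplit
    rw [eval_mul, eval_C, hlc, eval_multiset_prod, Multiset.map_map] at this
    rw [this]
    congr 1
    refine congrArg Multiset.prod (Multiset.map_congr rfl fun a _ ↦ ?_)
    simp
  -- valuations: `v(b₈) = v(3)²` but `v(3 ∏ (-ξ)) = v(3)`
  have hb8v : v (V.b₈ : AlgebraicClosure ℚ) = t ^ 2 := valuation_b₈_eq_of_shape V hb2 hb4 hb4' hb6
  have hprod : v ((F.roots.map (fun a ↦ (0 : AlgebraicClosure ℚ) - a)).prod) = 1 := by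
    refine Multiset.prod_induction (fun z ↦ v z = 1) _ (fun a b ha hb ↦ by rw [map_mul, ha, hb, mul_one])
      (map_one v) (fun z hz ↦ ?_)
    obtain ⟨a, ha, rfl⟩ := Multiset.mem_map.mp hz
    rw [zero_sub, Valuation.map_neg]
    exact hunit a ((mem_roots hF0).mp ha)
  have key : t ^ 2 = t := by
    rw [← hb8v, ← hev0, hev0', map_mul, hprod, mul_one]
  have : t * t = t * 1 := by rw [← sq, key, mul_one]
  exact absurd (mul_left_cancel₀ ht0 this) (ne_of_lt ht1)

end Summit.BirchSwinnertonDyer.Rank1Residual.GaloisImage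

end
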